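import Summits.CriticalPhenomena.PercolationContinuityZ3.Theorems.Transplant.TwoAxisExitFrame
import Literature.Probability.Percolation.SitePaths
import HarnessLib

/-!
# N1 (the `{±1}` node), LEVEL 1, kit adapter file N-K1: REACHING PLANAR POINTS BY QUASI-STEPS — straight quasi-walks, their link sets, the column
# vertex over a planar point, for a bare planar map `F : V → ℤ²` with `Skelφ.QSteps G F` (hp-8 g33, `TwoAxisExitFrame` p274987: every unit move of
# `F` through a `Link3`, a `G`-path of length `≤ 3` whose inner vertices keep the `F`-value of the start)

builds on p205010 (kernel theorem, internal audit signed; external expert review pending) — nothing in this file uses p205010; nothing here is a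
claim about the open node `SamePDropOfSkeletonNeg`.
Lane `prim-bschramm`, seat `prim-bschramm-p1` (gen 11; kit-layer port = p1 per design-owner ruling 2026-08-21 13:19:49Z (2)); helper file
(`--supports stmt-CriticalPhenomena-4575 --as helper`).
This is the `QSteps` twin of `SkelPhiSeedSlab` §1 (`walk`, `φ_walk`, `walk_mem_graphBall`, `colPt`) and `SkelPhiRectAt` §1 (`exists_mem_graphBall_φ_eq`):
the D″ kit layer sites kits by EXACT unit walks of the window map (`Skelφ.Steps`); the N1 window maps (run frames, face exit frames) only have
quasi-steps, so every walk step becomes a `Link3` (lengths `×3`), and the wired sets must carry the links' inner vertices — whose `F`-values are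
those of the walk points, so every FOOTPRINT statement survives verbatim.
* §1 `Link3.exists_walk` (a `G.Walk` of length `≤ 3`, every support vertex at `F w` or equal to `w′`), `Link3.pathIn` (joined inside any set
  containing the link's vertices);
* §2 `qstep` (a chosen `QSteps` endpoint) + `qstep_spec`; **`walkN G F i s v k`** (k quasi-steps along `s e_i`), `walkN_link`, **`F_walkN`**
  (`F p_k = F v + k s e_i`), **`walkN_mem_graphBall`** (`p_k ∈ B_G(v, 3k)`); `linkFin G F w w′` (the vertices of a chosen link) + `left/right_mem_linkFin`,
  `F_of_mem_linkFin`, `linkFin_subset_graphBall`, `card_linkFin_le`, `pathIn_of_linkFin_subset`;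
* §3 **`QSteps.exists_mem_graphBall_eq`** (every planar point `z` is `F g` for some `g ∈ B_G(v, 3‖z − F v‖₁)`), `colPtN` + `colPtN_spec`.
[cite: KozmaNitzan2024, §4 Lemma 10 Step III (p. 19), p. 21 (v(P) and its shift along the face), p. 26 ((29): columns)] [cite: MartineauTassion2017, §4.3]
-/

noncomputable section

namespace Summit.CriticalPhenomena.PercolationContinuityZ3.Theorems.Transplant

namespace Skelφ

open scoped Classical

open Literature.Probability.Percolation Literature.Probability.LatticeModels SimpleGraph
open Literature.Barriers.CriticalPhenomena (graphBall mem_graphBall_self graphBall_mono)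

variable {V : Type} {G : SimpleGraph V} {F : V → Site 2}

/-! ## §1 Links as walks -/

/-- **A link is a walk of length `≤ 3`** all of whose vertices are at the start value of `F` or equal to the far end. [folklore] -/
theorem Link3.exists_walk {w w' : V} (h : Link3 G F w w') :
    ∃ p : G.Walk w w', p.length ≤ 3 ∧ ∀ u ∈ p.support, F u = F w ∨ u = w' := by
  rcases h with h | ⟨m, h1, h2, hm⟩ | ⟨m, m', h1, h2, h3, hm, hm'⟩
  · refine ⟨Walk.cons h Walk.nil, by simp, fun u hu => ?_⟩
    rw [Walk.support_cons, Walk.support_nil, List.mem_cons, List.mem_singleton] at hu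
    rcases hu with rfl | rfl
    · exact Or.inl rfl
    · exact Or.inr rfl
  · refine ⟨Walk.cons h1 (Walk.cons h2 Walk.nil), by simp, fun u hu => ?_⟩
    rw [Walk.support_cons, Walk.support_cons, Walk.support_nil, List.mem_cons, List.mem_cons, List.mem_singleton] at hu
    rcases hu with rfl | rfl | rfl
    · exact Or.inl rfl
    · exact Or.inl hm
    · exact Or.inr rfl
  · refine ⟨Walk.cons h1 (Walk.cons h2 (Walk.cons h3 Walk.nil)), by simp, fun u hu => ?_⟩
    rw [Walk.support_cons, Walk.support_cons, Walk.support_cons, Walk.support_nil, List.mem_cons, List.mem_cons, List.mem_cons,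
      List.mem_singleton] at hu
    rcases hu with rfl | rfl | rfl | rfl
    · exact Or.inl rfl
    · exact Or.inl hm
    · exact Or.inl hm'
    · exact Or.inr rfl

/-- The vertices of a walk all lying in `A` are joined to its start inside `A`. [folklore] -/
theorem pathIn_of_walk_support_subset {A : Set V} {w w' : V} (p : G.Walk w w') (hA : ∀ u ∈ p.support, u ∈ A) :
    ∀ u ∈ p.support, PathIn G A w u := by
  induction p with
  | nil =>
    intro u hu
    rw [Walk.support_nil, List.mem_singleton] at hu
    subst hu
    exact PathIn.refl (hA _ (by simp))
  | @cons a b c hab q ih =>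
    intro u hu
    have ha : a ∈ A := hA a (by simp)
    have hq : ∀ u ∈ q.support, u ∈ A := fun u hu => hA u (by rw [Walk.support_cons]; exact List.mem_cons_of_mem _ hu)
    rw [Walk.support_cons, List.mem_cons] at hu
    rcases hu with rfl | hu
    · exact PathIn.refl ha
    · exact (PathIn.of_adj ha (hq b (by simp)) hab).trans (ih hq u hu)

/-! ## §2 Chosen quasi-steps, straight quasi-walks and their link sets -/

variable (G F) in
/-- **A chosen quasi-step** from `v` along `s e_i`: a vertex `v′` with `F v′ = F v + s e_i` linked to `v`, when there is one (always, under `QSteps`),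
else `v`. [this work] -/
def qstep (i : Fin 2) (s : ℤˣ) (v : V) : V :=
  if h : ∃ v' : V, F v' = F v + Pi.single i (s : ℤ) ∧ Link3 G F v v' then Classical.choose h else v

/-- Specification of the chosen quasi-step (under `QSteps`). [folklore] -/
theorem qstep_spec (hq : QSteps G F) (i : Fin 2) (s : ℤˣ) (v : V) :
    F (qstep G F i s v) = F v + Pi.single i (s : ℤ) ∧ Link3 G F v (qstep G F i s v) := by
  have h : ∃ v' : V, F v' = F v + Pi.single i (s : ℤ) ∧ Link3 G F v v' := hq v i s
  unfold qstep
  rw [dif_pos h]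
  exact Classical.choose_spec h

variable (G F) in
/-- **The straight quasi-walk** from `v` along `s e_i`: `p₀ = v`, `p_{k+1} = qstep (p_k)`. The `QSteps` twin of `Skelφ.walk`.
[cite: KozmaNitzan2024, §4 p. 21] -/
def walkN (i : Fin 2) (s : ℤˣ) (v : V) : ℕ → V
  | 0 => v
  | k + 1 => qstep G F i s (walkN i s v k)

/-- `p₀ = v`. [folklore] -/
@[simp] theorem walkN_zero (i : Fin 2) (s : ℤˣ) (v : V) : walkN G F i s v 0 = v := rfl

/-- `p_{k+1} = qstep p_k`. [folklore] -/
theorem walkN_succ (i : Fin 2) (s : ℤˣ) (v : V) (k : ℕ) : walkN G F i s v (k + 1) = qstep G F i s (walkN G F i s v k) := rfl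

/-- Consecutive quasi-walk vertices are linked and `F` moves by `s e_i` (under `QSteps`). [folklore] -/
theorem walkN_succ_spec (hq : QSteps G F) (i : Fin 2) (s : ℤˣ) (v : V) (k : ℕ) :
    Link3 G F (walkN G F i s v k) (walkN G F i s v (k + 1)) ∧ F (walkN G F i s v (k + 1)) = F (walkN G F i s v k) + Pi.single i (s : ℤ) := by
  rw [walkN_succ]
  exact ⟨(qstep_spec hq i s _).2, (qstep_spec hq i s _).1⟩

/-- Consecutive quasi-walk vertices are linked. [folklore] -/
theorem walkN_link (hq : QSteps G F) (i : Fin 2) (s : ℤˣ) (v : V) (k : ℕ) : Link3 G F (walkN G F i s v k) (walkN G F i s v (k + 1)) :=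
  (walkN_succ_spec hq i s v k).1

/-- **Planar coordinates along the quasi-walk**: `F p_k = F v + k s e_i`. [folklore] -/
theorem F_walkN (hq : QSteps G F) (i : Fin 2) (s : ℤˣ) (v : V) (k : ℕ) :
    F (walkN G F i s v k) = F v + Pi.single i ((k : ℤ) * (s : ℤ)) := by
  induction k with
  | zero => simp
  | succ k ih =>
    rw [(walkN_succ_spec hq i s v k).2, ih, add_assoc, ← Pi.single_add]
    congr 2; push_cast; ring

/-- **The quasi-walk stays in the graph ball**: `p_k ∈ B_G(v, 3k)`. [folklore] -/
theorem walkN_mem_graphBall (hq : QSteps G F) (i : Fin 2) (s : ℤˣ) (v : V) (k : ℕ) : walkN G F i s v k ∈ graphBall G v (3 * k) := by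
  induction k with
  | zero => exact mem_graphBall_self G v 0
  | succ k ih =>
    have h := BoxProdZ2.mem_graphBall_add G ih (walkN_link hq i s v k).mem_graphBall
    exact graphBall_mono G v (by omega) h

variable (G F) in
/-- **The vertices of a chosen link** `w — ⋯ — w′` (a walk of length `≤ 3` with every vertex at `F w` or equal to `w′`), when there is one (always,
for a `Link3`), else `{w}`. [this work] -/
def linkFin [DecidableEq V] (w w' : V) : Finset V :=
  if h : ∃ p : G.Walk w w', p.length ≤ 3 ∧ ∀ u ∈ p.support, F u = F w ∨ u = w' then (Classical.choose h).support.toFinset else {w}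

section LinkFin

variable [DecidableEq V]

/-- Under a link, `linkFin` is the support of a chosen short walk with the footprint property. [folklore] -/
theorem linkFin_spec {w w' : V} (h : Link3 G F w w') :
    ∃ p : G.Walk w w', p.length ≤ 3 ∧ (∀ u ∈ p.support, F u = F w ∨ u = w') ∧ linkFin G F w w' = p.support.toFinset := by
  have h' : ∃ p : G.Walk w w', p.length ≤ 3 ∧ ∀ u ∈ p.support, F u = F w ∨ u = w' := h.exists_walk
  refine ⟨Classical.choose h', (Classical.choose_spec h').1, (Classical.choose_spec h').2, ?_⟩
  unfold linkFin
  rw [dif_pos h']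

/-- The start belongs to the link set. [folklore] -/
theorem left_mem_linkFin (w w' : V) : w ∈ linkFin G F w w' := by
  unfold linkFin
  split_ifs with h
  · exact List.mem_toFinset.2 (Walk.start_mem_support _)
  · exact Finset.mem_singleton_self w

/-- Under a link, the far end belongs to the link set. [folklore] -/
theorem right_mem_linkFin {w w' : V} (h : Link3 G F w w') : w' ∈ linkFin G F w w' := by
  obtain ⟨p, -, -, hp⟩ := linkFin_spec h
  rw [hp]
  exact List.mem_toFinset.2 (Walk.end_mem_support _)

/-- **Footprint of a link set**: every vertex is at `F w` or is the far end (under a link). [folklore] -/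
theorem F_of_mem_linkFin {w w' : V} (h : Link3 G F w w') {u : V} (hu : u ∈ linkFin G F w w') : F u = F w ∨ u = w' := by
  obtain ⟨p, -, hF, hp⟩ := linkFin_spec h
  rw [hp, List.mem_toFinset] at hu
  exact hF u hu

/-- Without the link hypothesis the footprint still holds in the weak form `F u = F w ∨ u = w′`. [folklore] -/
theorem F_of_mem_linkFin' {w w' u : V} (hu : u ∈ linkFin G F w w') : F u = F w ∨ u = w' := by
  unfold linkFin at hu
  split_ifs at hu with h
  · exact (Classical.choose_spec h).2 u (List.mem_toFinset.1 hu)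
  · rw [Finset.mem_singleton] at hu; subst hu; exact Or.inl rfl

/-- The link set lies in `B_G(w, 3)`. [folklore] -/
theorem linkFin_subset_graphBall (w w' : V) : ∀ u ∈ linkFin G F w w', u ∈ graphBall G w 3 := by
  intro u hu
  unfold linkFin at hu
  split_ifs at hu with h
  · rw [List.mem_toFinset] at hu
    obtain ⟨hl, -⟩ := Classical.choose_spec h
    exact ⟨(Classical.choose h).takeUntil u hu, ((Classical.choose h).length_takeUntil_le_length hu).trans hl⟩
  · rw [Finset.mem_singleton] at hu; subst hu; exact mem_graphBall_self G _ 3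

/-- The link set has at most `4` vertices. [folklore] -/
theorem card_linkFin_le (w w' : V) : (linkFin G F w w').card ≤ 4 := by
  unfold linkFin
  split_ifs with h
  · obtain ⟨hl, -⟩ := Classical.choose_spec h
    refine (List.toFinset_card_le _).trans ?_
    rw [Walk.length_support]; omega
  · simp

/-- **The link set joins its ends inside any set containing it**: every vertex of `linkFin w w′` is joined to `w` by a `G`-path inside `A ⊇ linkFin w w′`. [folklore] -/
theorem pathIn_of_linkFin_subset {A : Set V} {w w' : V} (hA : ∀ u ∈ linkFin G F w w', u ∈ A) : ∀ u ∈ linkFin G F w w', PathIn G A w u := by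
  intro u hu
  unfold linkFin at hu hA
  split_ifs at hu hA with h
  · rw [List.mem_toFinset] at hu
    exact pathIn_of_walk_support_subset (Classical.choose h) (fun v hv => hA v (List.mem_toFinset.2 hv)) u hu
  · rw [Finset.mem_singleton] at hu; subst hu
    exact PathIn.refl (hA _ (Finset.mem_singleton_self _))

end LinkFin

/-! ## §3 Reaching planar points: the column vertex -/

/-- **Under `QSteps`, every planar point `z` is the image of a vertex within graph distance `3‖z − F v‖₁` of `v`** (two straight quasi-walks).
The `QSteps` twin of `Skelφ.exists_mem_graphBall_φ_eq`. [cite: KozmaNitzan2024, §4 p. 26 ((29))] -/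
theorem QSteps.exists_mem_graphBall_eq (hq : QSteps G F) (v : V) (z : Site 2) :
    ∃ g, g ∈ graphBall G v (3 * ((z 0 - F v 0).natAbs + (z 1 - F v 1).natAbs)) ∧ F g = z := by
  -- signs and lengths of the two legs
  obtain ⟨s₀, hs₀⟩ : ∃ s : ℤˣ, ((z 0 - F v 0).natAbs : ℤ) * (s : ℤ) = z 0 - F v 0 := by
    rcases le_or_gt 0 (z 0 - F v 0) with h | h
    · exact ⟨1, by rw [Units.val_one, mul_one]; exact Int.natAbs_of_nonneg h⟩
    · exact ⟨-1, by rw [Units.val_neg, Units.val_one, mul_neg, mul_one, Int.ofNat_natAbs_of_nonpos h.le]; ring⟩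
  set g₁ := walkN G F 0 s₀ v (z 0 - F v 0).natAbs with hg₁
  have hF₁ : F g₁ = F v + Pi.single 0 (z 0 - F v 0) := by rw [hg₁, F_walkN hq, hs₀]
  have hF₁0 : F g₁ 0 = z 0 := by rw [hF₁]; simp
  have hF₁1 : F g₁ 1 = F v 1 := by rw [hF₁]; simp
  obtain ⟨s₁, hs₁⟩ : ∃ s : ℤˣ, ((z 1 - F v 1).natAbs : ℤ) * (s : ℤ) = z 1 - F v 1 := by
    rcases le_or_gt 0 (z 1 - F v 1) with h | h
    · exact ⟨1, by rw [Units.val_one, mul_one]; exact Int.natAbs_of_nonneg h⟩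
    · exact ⟨-1, by rw [Units.val_neg, Units.val_one, mul_neg, mul_one, Int.ofNat_natAbs_of_nonpos h.le]; ring⟩
  set g := walkN G F 1 s₁ g₁ (z 1 - F v 1).natAbs with hg
  have hF : F g = F g₁ + Pi.single 1 (z 1 - F v 1) := by rw [hg, F_walkN hq, hs₁]
  refine ⟨g, ?_, ?_⟩
  · have h1 := walkN_mem_graphBall hq 0 s₀ v (z 0 - F v 0).natAbs
    have h2 := walkN_mem_graphBall hq 1 s₁ g₁ (z 1 - F v 1).natAbs
    exact graphBall_mono G v (by omega) (BoxProdZ2.mem_graphBall_add G h1 h2)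
  · funext j
    fin_cases j
    · show F g 0 = z 0
      rw [hF, Pi.add_apply, Pi.single_eq_of_ne (by decide), add_zero, hF₁0]
    · show F g 1 = z 1
      rw [hF, Pi.add_apply, Pi.single_eq_same, hF₁1]; ring

variable (G F) in
/-- **The column vertex** over the planar point `z` seen from `v`: a vertex `g` with `F g = z` within graph distance `3‖z − F v‖₁`, when there is
one (always, under `QSteps`), else `v`. The `QSteps` twin of `Skelφ.colPt`. [folklore] -/
def colPtN (v : V) (z : Site 2) : V :=
  if h : ∃ g, g ∈ graphBall G v (3 * ((z 0 - F v 0).natAbs + (z 1 - F v 1).natAbs)) ∧ F g = z then Classical.choose h else v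

/-- Specification of the column vertex (under `QSteps`). [folklore] -/
theorem colPtN_spec (hq : QSteps G F) (v : V) (z : Site 2) :
    colPtN G F v z ∈ graphBall G v (3 * ((z 0 - F v 0).natAbs + (z 1 - F v 1).natAbs)) ∧ F (colPtN G F v z) = z := by
  have h := hq.exists_mem_graphBall_eq v z
  unfold colPtN
  rw [dif_pos h]
  exact Classical.choose_spec h

end Skelφ

end Summit.CriticalPhenomena.PercolationContinuityZ3.Theorems.Transplant

end
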